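import Summits.BirchSwinnertonDyer.BirchSwinnertonDyer.Theorems.SignedLowerHalvesSmallImageLowerHalfBothSignsRttEngineOfPartnerSelmerBoundNs
import Summits.BirchSwinnertonDyer.BirchSwinnertonDyer.Theorems.SignedLowerHalvesSmallImageLowerHalfBothSignsRttOneSidedCruxTieredUnit
import HarnessLib

/-!
# Route `SignedLowerHalves`, crux L `SmallImageLowerHalfBothSigns` (item stmt-BirchSwinnertonDyer-23599), line `rtt_w3` v5 —
# the engine text ENG_T3 (hypothesis `hENG3` of `smallImageLowerHalfBothSigns_of_oneSignFloor_of_rtt_ge_tiered3`, p752208)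
# FROM the partner Selmer bound with the same two guards (PSB_T3 = the v5 registered stub `stub_partnerSelmerBoundT3_ns`)

LEAD `cruxlead-stmt-BirchSwinnertonDyer-23599` g3 (cell `bsd-ssimc`); ROUTE-INDEPENDENT helper (`--supports stmt-BirchSwinnertonDyer-23599`);
THEOREMS ONLY — no definition, no named fact, no `sorry`; closes nothing; BSD is not proved by any of this.

WHAT. The v5 skeleton of line `rtt_w3` registers the research residue of the engine in the partner-Selmer-bound currency (PSB, width seat
`bsd-line-slh-p3-w3` g12, `partnerLayerLambdaLowerT2_ns_of_partnerSelmerBoundT2_ns`, p749357) AND on tier T3 only (pairs with neither a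
CM-curve partner — engine landed p745857 — nor a unit curve partner — engine landed p750944; composition `…_tiered3`, p752208). This file is
the one-line-per-binder glue between the two: `partnerLayerLambdaLowerT3_ns_of_partnerSelmerBoundT3_ns : PSB_T3_ns → ENG_T3_ns`, i.e.
p749357's theorem with the extra guard «no unit curve partner» threaded through (it is idle in the proof, exactly like the T2 guard).
The pointwise engine is `partnerLayerLambdaLower_of_partnerSelmerBound` (p749152).

References: [Pollack2003] Prop. 6.18; [PollackWeston2011MT] §3.1, Thm. 4.1; [GreenbergVatsal2000] §2 Prop. (2.4); [HatleyLei2019]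
Thm. 4.6; [Kobayashi2003] Thm. 1.2, (3.6); [BDKim2009] Cor. 2.13.
-/

set_option autoImplicit false
-- D-0017: single-problem summit, the namespace repeats the problem name by design.
set_option linter.dupNamespace false
noncomputable section

open scoped Classical MatrixGroups ModularForm BigOperators

open CongruenceSubgroup WeierstrassCurve Field Polynomial NumberField IsDedekindDomain
  Literature.NumberTheory.EllipticCurves Literature.NumberTheory.EllipticCurves.ModularForms
  Literature.NumberTheory.EllipticCurves.Rank1Residual
  Literature.NumberTheory.EllipticCurves.Kobayashi2003
  Literature.NumberTheory.EllipticCurves.GreenbergVatsal2000 ZpExtension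
  Literature.NumberTheory.IwasawaTheory Rat.HeightOneSpectrum
  Summit.BirchSwinnertonDyer.Rank1Residual.Supersingular
  Summit.BirchSwinnertonDyer.Rank1Residual.X1.MuLambda
  Summit.BirchSwinnertonDyer.Rank1Residual.X2.EulerFactorInvariants

namespace Summit.BirchSwinnertonDyer.BirchSwinnertonDyer.Theorems.SmallImageRttLayerLawK

/-- **ENG_T3 (v5 composition hypothesis `hENG3` of `…_tiered3`, VERBATIM: v4's ENG_T2 text + the guard «no unit curve partner») ⟸
(PSB) with the same two guards** (= the v5 registered stub `stub_partnerSelmerBoundT3_ns` VERBATIM). Both guards are idle: the proof is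
p749357's, binder for binder, through the pointwise engine `partnerLayerLambdaLower_of_partnerSelmerBound`.
[cite: Pollack2003, Prop. 6.18] [cite: PollackWeston2011MT, §3.1 and Thm. 4.1] [cite: GreenbergVatsal2000, §2 Prop. (2.4) and §1 (9)]
[cite: HatleyLei2019, Thm. 4.6] -/
theorem partnerLayerLambdaLowerT3_ns_of_partnerSelmerBoundT3_ns :
    (∀ (W : WeierstrassCurve ℚ) [W.IsElliptic] [W.IsGloballyMinimal] (p : ℕ) [Fact p.Prime],
      p ≠ 2 → ClassX7 W p → ¬ W.HasCM → W.frobeniusTrace p = 0 → ¬ Surj W p →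
      ¬ (∃ (A : WeierstrassCurve ℚ) (_ : A.IsElliptic) (_ : A.IsGloballyMinimal),
        A.HasCM ∧ GoodSS A p ∧ A.frobeniusTrace p = 0 ∧
          ∃ e : geomTorsion W (p : ℤ) ≃+ geomTorsion A (p : ℤ),
            ∀ (σ : absoluteGaloisGroup ℚ) (P : geomTorsion W (p : ℤ)), e (σ • P) = σ • e P) →
      ¬ (∃ (A : WeierstrassCurve ℚ) (_ : A.IsElliptic) (_ : A.IsGloballyMinimal) (t : ℚ),
        A.HasGoodReductionAtPrime p ∧ A.frobeniusTrace p = 0 ∧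
          (∃ e : geomTorsion W (p : ℤ) ≃+ geomTorsion A (p : ℤ),
            ∀ (σ : absoluteGaloisGroup ℚ) (P : geomTorsion W (p : ℤ)), e (σ • P) = σ • e P) ∧
          A.entireLFunction 1 / (A.realPeriodRat : ℂ) = ((t : ℚ) : ℂ) ∧ t ≠ 0 ∧ padicValRat p t = 0) →
      ∀ (ε : ℤˣ), ∀ (M : ℕ) [NeZero M] (g : CuspForm (Gamma0 M) 2) (ι : coeffField g →+* PadicAlgCl p) (Ω : ℂ),
        ¬ p ∣ M → (∀ ℓ : ℕ, ℓ.Prime → ℓ ≠ p → max 2 (padicValNat ℓ M) = max 2 (padicValNat ℓ (W.conductorNorm ℤ))) →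
        IsNewform0 g → Literature.NumberTheory.Automorphic.IsCMForm (liftToGamma1 M 2 g) →
        cuspCoeff g p = 0 → IsCohomologicalPlusPeriod g ι Ω →
        (∀ ℓ : ℕ, ℓ.Prime → ¬ ℓ ∣ p * M * W.conductorNorm ℤ →
          ‖embCoeff g ι ℓ - (W.frobeniusTrace ℓ : PadicAlgCl p)‖ < 1) →
        ∀ (κ : ZpExtension ℚ p) (γ : absoluteGaloisGroup ℚ),
          κ.IsCyclotomic → κ.IsTopGenerator γ → IsCyclotomicVariable p γ →
        ∀ (S₀ : Finset (HeightOneSpectrum (𝓞 ℚ))), (∀ v ∈ S₀, ((p : ℕ) : 𝓞 ℚ) ∉ v.asIdeal) →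
          (∀ v : HeightOneSpectrum (𝓞 ℚ), ¬ W.HasGoodReductionAt v → v ∈ S₀) →
          (∀ v : HeightOneSpectrum (𝓞 ℚ), natGenerator v ∣ M → v ∈ S₀) →
        ∀ (D : SignedSelmerDualData W κ γ ε) [Module.Finite (IwasawaAlgebra p) D.X],
          Module.IsTorsion (IwasawaAlgebra p) D.X → D.mu = 0 →
        ∀ L : IwasawaAlgebraO (Set.range ι), L ≠ 0 →
          (∀ n : ℕ, (Even n ↔ ε = 1) → IsCongrModOmegaO (Set.range ι) n ((mazurTateElementK g Ω p n).map ι)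
            (((((-1) ^ (n / 2 + 1) * (if ε = 1 then cyclotomicOmegaMinus p n else cyclotomicOmegaPlus p n)).map
                (Int.castRingHom (PadicAlgCl p)) : (PadicAlgCl p)[X]) : PowerSeries (PadicAlgCl p)) *
              iwasawaOToPowerSeries (Set.range ι) L)) →
          ∃ d : ℕ, (∀ k : ℕ, ‖PowerSeries.coeff k (iwasawaOToPowerSeries (Set.range ι) L)‖ ≤
              ‖PowerSeries.coeff d (iwasawaOToPowerSeries (Set.range ι) L)‖) ∧
            (∀ k : ℕ, k < d → ‖PowerSeries.coeff k (iwasawaOToPowerSeries (Set.range ι) L)‖ <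
              ‖PowerSeries.coeff d (iwasawaOToPowerSeries (Set.range ι) L)‖) ∧
            d + ∑ v ∈ S₀, p ^ (frobeniusExponent p (natGenerator v : ℤ_[p])).valuation *
              layerLambda ((1 - C (embCoeff g ι (natGenerator v)) * X +
                (if natGenerator v ∣ M then 0 else C (natGenerator v : PadicAlgCl p)) * X ^ 2).comp
                  (C ((natGenerator v : PadicAlgCl p)⁻¹) * (X + 1))) ≤
              lambdaInvariant p D.X + ∑ v ∈ S₀, delta W p v) →
    ∀ (W : WeierstrassCurve ℚ) [W.IsElliptic] [W.IsGloballyMinimal] (p : ℕ) [Fact p.Prime],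
      p ≠ 2 → ClassX7 W p → ¬ W.HasCM → W.frobeniusTrace p = 0 → ¬ Surj W p →
      ¬ (∃ (A : WeierstrassCurve ℚ) (_ : A.IsElliptic) (_ : A.IsGloballyMinimal),
        A.HasCM ∧ GoodSS A p ∧ A.frobeniusTrace p = 0 ∧
          ∃ e : geomTorsion W (p : ℤ) ≃+ geomTorsion A (p : ℤ),
            ∀ (σ : absoluteGaloisGroup ℚ) (P : geomTorsion W (p : ℤ)), e (σ • P) = σ • e P) →
      ¬ (∃ (A : WeierstrassCurve ℚ) (_ : A.IsElliptic) (_ : A.IsGloballyMinimal) (t : ℚ),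
        A.HasGoodReductionAtPrime p ∧ A.frobeniusTrace p = 0 ∧
          (∃ e : geomTorsion W (p : ℤ) ≃+ geomTorsion A (p : ℤ),
            ∀ (σ : absoluteGaloisGroup ℚ) (P : geomTorsion W (p : ℤ)), e (σ • P) = σ • e P) ∧
          A.entireLFunction 1 / (A.realPeriodRat : ℂ) = ((t : ℚ) : ℂ) ∧ t ≠ 0 ∧ padicValRat p t = 0) →
      ∀ (ε : ℤˣ), ∀ (M : ℕ) [NeZero M] (g : CuspForm (Gamma0 M) 2) (ι : coeffField g →+* PadicAlgCl p) (Ω : ℂ),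
        ¬ p ∣ M → (∀ ℓ : ℕ, ℓ.Prime → ℓ ≠ p → max 2 (padicValNat ℓ M) = max 2 (padicValNat ℓ (W.conductorNorm ℤ))) →
        IsNewform0 g → Literature.NumberTheory.Automorphic.IsCMForm (liftToGamma1 M 2 g) →
        cuspCoeff g p = 0 → IsCohomologicalPlusPeriod g ι Ω →
        (∀ ℓ : ℕ, ℓ.Prime → ¬ ℓ ∣ p * M * W.conductorNorm ℤ →
          ‖embCoeff g ι ℓ - (W.frobeniusTrace ℓ : PadicAlgCl p)‖ < 1) →
        ∀ (κ : ZpExtension ℚ p) (γ : absoluteGaloisGroup ℚ),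
          κ.IsCyclotomic → κ.IsTopGenerator γ → IsCyclotomicVariable p γ →
        ∀ (S₀ : Finset (HeightOneSpectrum (𝓞 ℚ))), (∀ v ∈ S₀, ((p : ℕ) : 𝓞 ℚ) ∉ v.asIdeal) →
          (∀ v : HeightOneSpectrum (𝓞 ℚ), ¬ W.HasGoodReductionAt v → v ∈ S₀) →
          (∀ v : HeightOneSpectrum (𝓞 ℚ), natGenerator v ∣ M → v ∈ S₀) →
        ∀ (D : SignedSelmerDualData W κ γ ε) [Module.Finite (IwasawaAlgebra p) D.X],
          Module.IsTorsion (IwasawaAlgebra p) D.X → D.mu = 0 →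
        ∃ n₀ : ℕ, ∀ n ≥ n₀, (Even n ↔ ε = 1) →
          ((layerLambda (((mazurTateElementK g Ω p n).map ι *
              ∏ v ∈ S₀, (1 - C (embCoeff g ι (natGenerator v)) * X +
                  (if natGenerator v ∣ M then 0 else C (natGenerator v : PadicAlgCl p)) * X ^ 2).comp
                (C ((natGenerator v : PadicAlgCl p)⁻¹) *
                  (X + 1) ^ (PadicInt.toZModPow n (-(frobeniusExponent p (natGenerator v : ℤ_[p])))).val)) %ₘ
              ((X + 1) ^ p ^ n - 1)) : ℕ) : ℤ) ≤
            ((if ε = 1 then cyclotomicOmegaMinus p n else cyclotomicOmegaPlus p n).natDegree : ℤ) +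
              ((lambdaInvariant p D.X : ℕ) : ℤ) + ((∑ v ∈ S₀, delta W p v : ℕ) : ℤ) := by
  intro hPSB W _ _ p _ hp2 hX7 hcm hap hns hT2 hT1u ε M _ g ι Ω hpM hlev hnew hcmg hapg hΩ hcong κ γ hκ hγ hγ' S₀ hS₀p hS₀W
    hS₀M D _ hXt hμ
  obtain ⟨n₀, hn₀⟩ := partnerLayerLambdaLower_of_partnerSelmerBound g ι Ω hnew hΩ hpM hapg ε S₀ hS₀p
    (lambdaInvariant p D.X + ∑ v ∈ S₀, delta W p v)
    (hPSB W p hp2 hX7 hcm hap hns hT2 hT1u ε M g ι Ω hpM hlev hnew hcmg hapg hΩ hcong κ γ hκ hγ hγ' S₀ hS₀p hS₀W hS₀M D hXt hμ)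
  refine ⟨n₀, fun n hn hpar ↦ ?_⟩
  have h' : ((layerLambda (((mazurTateElementK g Ω p n).map ι *
              ∏ v ∈ S₀, (1 - C (embCoeff g ι (natGenerator v)) * X +
                  (if natGenerator v ∣ M then 0 else C (natGenerator v : PadicAlgCl p)) * X ^ 2).comp
                (C ((natGenerator v : PadicAlgCl p)⁻¹) *
                  (X + 1) ^ (PadicInt.toZModPow n (-(frobeniusExponent p (natGenerator v : ℤ_[p])))).val)) %ₘ
              ((X + 1) ^ p ^ n - 1)) : ℕ) : ℤ) ≤
      (((if ε = 1 then cyclotomicOmegaMinus p n else cyclotomicOmegaPlus p n).natDegree +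
        (lambdaInvariant p D.X + ∑ v ∈ S₀, delta W p v) : ℕ) : ℤ) := by
    exact_mod_cast hn₀ n hn hpar
  simp only [Nat.cast_add] at h'
  linarith

/-- **The v5 composition target with the engine in PSB currency**: crux L `SmallImageLowerHalfBothSigns` BY NAME from the twelve
published facts of the cite stub, the one-sign floor at `p ≥ 5`, Kan₂ (landed p747435, fed Vatsal's `hV`) and **PSB_T3** — i.e.
`smallImageLowerHalfBothSigns_of_oneSignFloor_of_rtt_ge_tiered3` (p752208) with `hENG3` supplied by
`partnerLayerLambdaLowerT3_ns_of_partnerSelmerBoundT3_ns`. CONDITIONAL (every input displayed); closes nothing; BSD NOT proved.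
[cite: Kobayashi2003, Conjecture (p. 2), Thm. 7.4 (p. 13)] [cite: Pollack2003, Conj. 6.3] [cite: PollackWeston2011MT, §3.1, Thm. 4.1 (1)] -/
theorem smallImageLowerHalfBothSigns_of_oneSignFloor_of_psbT3
    (hJ : thm62_63_73_signedColemanKato_zetaJoint) (h12 : thm12_signedSelmerDual_finite_torsion)
    (h41 : thm41_signedCharIdeal_divisibility)
    (h5 : realPeriodRat_eq_unit_mul_plusPeriod) (h3 : realPeriodRat_eq_unit_mul_plusPeriod_three)
    (hD : Hida2000_thm326_exists_galoisRep) (hC : Carayol1986_artinConductorExponent)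
    (hS : ∀ (V : WeierstrassCurve ℚ) (ℓ : ℕ) [Fact ℓ.Prime],
      V.swanConductorAt_rationalTate_eq_wildConductorExponent_of_ringChar_eq_two ℓ)
    (hmod : exists_isNewformOf)
    (hKim : BDKim2009.cor213_signedLambda_add_sum_delta_eq_of_torsionIso)
    (hPR : PollackRubin2004.mainTheorem_signedCharIdeal_eq_of_cm) (hV : vatsal1999_plusSymbol_congruence)
    (hfloor5 : ∀ (W : WeierstrassCurve ℚ) [W.IsElliptic] [W.IsGloballyMinimal] (p : ℕ) [Fact p.Prime],
      5 ≤ p → ClassX7 W p → ¬ W.HasCM → W.frobeniusTrace p = 0 → ¬ Surj W p →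
      ∀ [NeZero (W.conductorNorm ℤ)] (f : CuspForm (Gamma0 (W.conductorNorm ℤ)) 2),
        IsNewformOf W f → ∃ (ε₀ : ℤˣ) (L₀ : IwasawaAlgebra p), IsSignedPAdicLFunction f p ε₀ L₀ ∧ HasUnitContent L₀)
    (hPSB3 : ∀ (W : WeierstrassCurve ℚ) [W.IsElliptic] [W.IsGloballyMinimal] (p : ℕ) [Fact p.Prime],
      p ≠ 2 → ClassX7 W p → ¬ W.HasCM → W.frobeniusTrace p = 0 → ¬ Surj W p →
      ¬ (∃ (A : WeierstrassCurve ℚ) (_ : A.IsElliptic) (_ : A.IsGloballyMinimal),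
        A.HasCM ∧ GoodSS A p ∧ A.frobeniusTrace p = 0 ∧
          ∃ e : geomTorsion W (p : ℤ) ≃+ geomTorsion A (p : ℤ),
            ∀ (σ : absoluteGaloisGroup ℚ) (P : geomTorsion W (p : ℤ)), e (σ • P) = σ • e P) →
      ¬ (∃ (A : WeierstrassCurve ℚ) (_ : A.IsElliptic) (_ : A.IsGloballyMinimal) (t : ℚ),
        A.HasGoodReductionAtPrime p ∧ A.frobeniusTrace p = 0 ∧
          (∃ e : geomTorsion W (p : ℤ) ≃+ geomTorsion A (p : ℤ),
            ∀ (σ : absoluteGaloisGroup ℚ) (P : geomTorsion W (p : ℤ)), e (σ • P) = σ • e P) ∧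
          A.entireLFunction 1 / (A.realPeriodRat : ℂ) = ((t : ℚ) : ℂ) ∧ t ≠ 0 ∧ padicValRat p t = 0) →
      ∀ (ε : ℤˣ), ∀ (M : ℕ) [NeZero M] (g : CuspForm (Gamma0 M) 2) (ι : coeffField g →+* PadicAlgCl p) (Ω : ℂ),
        ¬ p ∣ M → (∀ ℓ : ℕ, ℓ.Prime → ℓ ≠ p → max 2 (padicValNat ℓ M) = max 2 (padicValNat ℓ (W.conductorNorm ℤ))) →
        IsNewform0 g → Literature.NumberTheory.Automorphic.IsCMForm (liftToGamma1 M 2 g) →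
        cuspCoeff g p = 0 → IsCohomologicalPlusPeriod g ι Ω →
        (∀ ℓ : ℕ, ℓ.Prime → ¬ ℓ ∣ p * M * W.conductorNorm ℤ →
          ‖embCoeff g ι ℓ - (W.frobeniusTrace ℓ : PadicAlgCl p)‖ < 1) →
        ∀ (κ : ZpExtension ℚ p) (γ : absoluteGaloisGroup ℚ),
          κ.IsCyclotomic → κ.IsTopGenerator γ → IsCyclotomicVariable p γ →
        ∀ (S₀ : Finset (HeightOneSpectrum (𝓞 ℚ))), (∀ v ∈ S₀, ((p : ℕ) : 𝓞 ℚ) ∉ v.asIdeal) →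
          (∀ v : HeightOneSpectrum (𝓞 ℚ), ¬ W.HasGoodReductionAt v → v ∈ S₀) →
          (∀ v : HeightOneSpectrum (𝓞 ℚ), natGenerator v ∣ M → v ∈ S₀) →
        ∀ (D : SignedSelmerDualData W κ γ ε) [Module.Finite (IwasawaAlgebra p) D.X],
          Module.IsTorsion (IwasawaAlgebra p) D.X → D.mu = 0 →
        ∀ L : IwasawaAlgebraO (Set.range ι), L ≠ 0 →
          (∀ n : ℕ, (Even n ↔ ε = 1) → IsCongrModOmegaO (Set.range ι) n ((mazurTateElementK g Ω p n).map ι)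
            (((((-1) ^ (n / 2 + 1) * (if ε = 1 then cyclotomicOmegaMinus p n else cyclotomicOmegaPlus p n)).map
                (Int.castRingHom (PadicAlgCl p)) : (PadicAlgCl p)[X]) : PowerSeries (PadicAlgCl p)) *
              iwasawaOToPowerSeries (Set.range ι) L)) →
          ∃ d : ℕ, (∀ k : ℕ, ‖PowerSeries.coeff k (iwasawaOToPowerSeries (Set.range ι) L)‖ ≤
              ‖PowerSeries.coeff d (iwasawaOToPowerSeries (Set.range ι) L)‖) ∧
            (∀ k : ℕ, k < d → ‖PowerSeries.coeff k (iwasawaOToPowerSeries (Set.range ι) L)‖ <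
              ‖PowerSeries.coeff d (iwasawaOToPowerSeries (Set.range ι) L)‖) ∧
            d + ∑ v ∈ S₀, p ^ (frobeniusExponent p (natGenerator v : ℤ_[p])).valuation *
              layerLambda ((1 - C (embCoeff g ι (natGenerator v)) * X +
                (if natGenerator v ∣ M then 0 else C (natGenerator v : PadicAlgCl p)) * X ^ 2).comp
                  (C ((natGenerator v : PadicAlgCl p)⁻¹) * (X + 1))) ≤
              lambdaInvariant p D.X + ∑ v ∈ S₀, delta W p v) :
    Summit.BirchSwinnertonDyer.BirchSwinnertonDyer.Theses.SignedLowerHalves.SmallImageLowerHalfBothSigns :=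
  SmallImageRttOneSided.smallImageLowerHalfBothSigns_of_oneSignFloor_of_rtt_ge_tiered3 hJ h12 h41 h5 h3 hD hC hS hmod hKim hPR hV
    hfloor5 (SmallImageRttKan.stub_thetaLayerLambda_ns hV) (partnerLayerLambdaLowerT3_ns_of_partnerSelmerBoundT3_ns hPSB3)

end Summit.BirchSwinnertonDyer.BirchSwinnertonDyer.Theorems.SmallImageRttLayerLawK

end
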